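/-
Origin: expansion seat `planner-pub-hodgecm-pv02-0`, handover 2026-08-18T03:29:04Z (`HOME/pub-hodgecm-pv02/lean/HodgeCM/PerL34/P43_lineSpan.lean`, md5 6d341a81, 291 lines);
landed by the gen-5 packager in gate run 18 as `HodgeCM/PerL34/P43_lineSpan.lean` (verbatim).
-/
/-
pub-hodgecm formalisation cell (harness21, 2026). New file (not vendored).
Origin: DAG-node prover pv02 (session planner-pub-hodgecm-pv02-0, unit pub-hodgecm-pv02), node N33c of HOME/LEMMAS.md
(carver v1). Intended final place: `HodgeCM/PerL34/P43_lineSpan.lean` (the carver's planned stub name for N33c).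
Imports `Mathlib` only: the node is stated over a PLACEHOLDER DATA structure (LEMMAS.md §3, defs-needed D2/D6 — the
package has no vocabulary for automorphic forms as functions on `G_U(𝔸)` nor for one-forms on `𝔹²`), exactly as the
carver announced it would type such nodes ("placeholder `Prop` over a posited DATA structure until the def exists").
-/
import Mathlib

set_option autoImplicit false

/-!
# PerL v5 Prop 4.3 (`prop:S12`), proof step **N33c**: the spans `𝒰_i` (tex ll. 658–660)

VERBATIM (PerL v5 = `HOME/inputs/2001/…galois-closure__free__y1__paper__paper.tex`, blob d912a121, ll. 658–660):
```
658: \[\mathcal U_i:=\mathrm{span}\{u_f:\ f\in\Theta_i(\chi'_i)[\fp_+],\ \chi'_i\text{ automorphic of type }e(\Psi_i)\},\]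
659: a complex vector space of holomorphic $1$-forms on $\mathbb B^2$, stable under $\gamma^*$ for $\gamma\in G_U(L_0)$, and non-zero
660: (if $u_f=0$ for all such $f$ then, replacing $f$ by its $G_U(\A_f)$-translates, $f=0$).
```
This is the R1 FIRST-ERROR repair site (review `…reviews__2026-08-09-open.md`, "First error"): in v1 the spans ran over ALL
`π ∈ 𝒜^{1,0}` with `Φ'(π) = Ψ_i`; since v2 they run over the automorphic characters `χ'_i` of `[U(W_i)]` of archimedean
type `e(Ψ_i)` ONLY, for the FIXED line and splitting character `(W_i, μ_i)` of §3.2.  In the typing below this is the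
index type `X i` of `LineSpanData` (one index per such `χ'_i`; the lines `(W_i, μ_i)` are not parameters at all).

## What is proved here, and from what

The three assertions of ll. 659–660 — (1) `𝒰_i` consists of holomorphic one-forms, (2) `γ^* 𝒰_i = 𝒰_i` for
`γ ∈ G_U(L₀)`, (3) `𝒰_i ≠ 0` — are KERNEL-PROVED (`N33c_of`) in the function model of PerL §3.1 (tex ll. 239–247:
forms are `τ`-valued `K_∞`-finite functions on `G_U(L₀)\G_U(𝔸)`; `u_f(g_{ι₁}) := (f¹,f²)(g_{ι₁},1,…,1;1_f)`,
l. 653–655) from exactly these inputs, each the output of ANOTHER NODE of the DAG (no literature is cited here):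
* `LineSpanData.LeftInvariant` / `.CompactInvariant` (N09/N10, tex ll. 239–247, 264–268, 654): an element of
  `Θ_i(χ'_i)[𝔭₊]` is a function on `G_U(L₀)\G_U(𝔸)`, i.e. left `G_U(L₀)`-invariant, and — having `K_∞`-type
  `𝔭₊ ⊠ 𝟏`, `K_∞ = K_{ι₁} × ∏_{b≠ι₁} U(3)` where `U(V_{3,b})(ℝ) = U(3)` is the WHOLE local factor — invariant under the
  compact factors ("`f` is invariant under the compact factors", l. 654);
* `LineSpanData.FiniteStable` (N10, tex ll. 264–268: `Θ^W_μ(χ')` is a `(𝔤,K_∞) × G_U(𝔸_f)`-module, and `R(h_f)`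
  commutes with `K_∞`, so it preserves the `𝔭₊ ⊠ 𝟏`-isotypic part; used at l. 656 and l. 660);
* `LineSpanData.UHolomorphic` (N33b, tex ll. 650–655: `u_f` is a holomorphic one-form on `𝔹²`);
* `LineSpanData.SomeNonzero` (N30 = Lemma 4.2(a), tex ll. 527–529: automorphic characters of every archimedean type
  exist; with N33a, tex ll. 644–650: `Θ_i(χ'_i)[𝔭₊] ≠ 0` for every such `χ'_i`).
The equivariance `γ^* u_f = u_{R(γ_f⁻¹) f}` of N33b (l. 656) is not assumed: in the function model it is the two-line
computation `uEval_lTransl` from left invariance and compact-factor invariance, reproduced here.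

The abstract linear-algebra layer (`USpan*`, any linear `u : A →ₗ[ℂ] Ω`) is kept separate so that the statements can
be instantiated on whatever carrier the carver's stub / the N33b, N33d, N33e provers choose.
-/

namespace HodgeCM.PerL34.P43

/-! ### Abstract layer: spans of images of a family of subspaces under a linear map -/

section Abstract

variable {A Ω : Type*} [AddCommMonoid A] [Module ℂ A] [AddCommMonoid Ω] [Module ℂ Ω] {X : Type*}

/-- `𝒰 := span{ u f : f ∈ Θ χ, χ ∈ X }` (PerL l. 658 with `Θ χ = Θ_i(χ'_i)[𝔭₊]`, `u f = u_f`). -/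
def USpan (u : A →ₗ[ℂ] Ω) (Θ : X → Submodule ℂ A) : Submodule ℂ Ω :=
  Submodule.span ℂ {ω | ∃ χ, ∃ f ∈ Θ χ, u f = ω}

variable (u : A →ₗ[ℂ] Ω) (Θ : X → Submodule ℂ A)

/-- (Ported verbatim from the HodgeCMPerL package; no docstring in the source.) -/
theorem mem_USpan_of_mem {χ : X} {f : A} (hf : f ∈ Θ χ) : u f ∈ USpan u Θ :=
  Submodule.subset_span ⟨χ, f, hf, rfl⟩

/-- `𝒰 = Σ_χ u(Θ χ)`. -/
theorem USpan_eq_iSup : USpan u Θ = ⨆ χ, (Θ χ).map u := by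
  apply le_antisymm
  · refine Submodule.span_le.mpr ?_
    rintro ω ⟨χ, f, hf, rfl⟩
    exact Submodule.mem_iSup_of_mem χ (Submodule.mem_map_of_mem hf)
  · refine iSup_le fun χ => ?_
    rintro ω ⟨f, hf, rfl⟩
    exact mem_USpan_of_mem u Θ hf

/-- (1) If every `u f`, `f ∈ Θ χ`, lies in a subspace `H` (the holomorphic one-forms), so does `𝒰`. -/
theorem USpan_le {H : Submodule ℂ Ω} (h : ∀ χ, ∀ f ∈ Θ χ, u f ∈ H) : USpan u Θ ≤ H :=
  Submodule.span_le.mpr (by rintro ω ⟨χ, f, hf, rfl⟩; exact h χ f hf)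

/-- (2) Stability: if `pull (u f) = u (ρ f)` with `ρ f ∈ Θ χ` for `f ∈ Θ χ` (PerL l. 656:
`γ^* u_f = u_{R(γ_f⁻¹) f}`, `R(γ_f⁻¹) f ∈ Θ_i(χ'_i)[𝔭₊]`), then `pull 𝒰 ≤ 𝒰`. -/
theorem USpan_map_le (pull : Ω →ₗ[ℂ] Ω) (ρ : A →ₗ[ℂ] A) (hΘ : ∀ χ, ∀ f ∈ Θ χ, ρ f ∈ Θ χ)
    (heq : ∀ χ, ∀ f ∈ Θ χ, pull (u f) = u (ρ f)) : (USpan u Θ).map pull ≤ USpan u Θ := by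
  refine (Submodule.map_span_le pull _ _).mpr ?_
  rintro ω ⟨χ, f, hf, rfl⟩
  rw [heq χ f hf]
  exact mem_USpan_of_mem u Θ (hΘ χ _ hf)

/-- (2') … with equality when `pull` has an inverse `pull'` that also maps `𝒰` into itself. -/
theorem USpan_map_eq (pull pull' : Ω →ₗ[ℂ] Ω) (hinv : ∀ ω, pull (pull' ω) = ω)
    (h : (USpan u Θ).map pull ≤ USpan u Θ) (h' : (USpan u Θ).map pull' ≤ USpan u Θ) :
    (USpan u Θ).map pull = USpan u Θ := by
  refine le_antisymm h fun ω hω => ?_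
  exact ⟨pull' ω, h' (Submodule.mem_map_of_mem hω), hinv ω⟩

/-- (3) `𝒰 ≠ 0` as soon as one `u f ≠ 0`. -/
theorem USpan_ne_bot_of_ne_zero (h : ∃ χ, ∃ f ∈ Θ χ, u f ≠ 0) : USpan u Θ ≠ ⊥ := by
  obtain ⟨χ, f, hf, hne⟩ := h
  intro hbot
  exact hne ((Submodule.eq_bot_iff _).mp hbot _ (mem_USpan_of_mem u Θ hf))

/-- (3') PerL l. 660: "if `u_f = 0` for all such `f` then, replacing `f` by its `G_U(𝔸_f)`-translates, `f = 0`":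
if the `Θ χ` are stable under a family of translations `T h` and an `f` all of whose translates have `u = 0`
vanishes (`sep`), then `𝒰 ≠ 0` as soon as some `Θ χ ≠ 0`. -/
theorem USpan_ne_bot {Hf : Type*} (T : Hf → (A →ₗ[ℂ] A)) (hT : ∀ h χ, ∀ f ∈ Θ χ, T h f ∈ Θ χ)
    (sep : ∀ χ, ∀ f ∈ Θ χ, (∀ h, u (T h f) = 0) → f = 0) (hex : ∃ χ, Θ χ ≠ ⊥) : USpan u Θ ≠ ⊥ := by
  obtain ⟨χ, hχ⟩ := hex
  apply USpan_ne_bot_of_ne_zero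
  by_contra! hall
  apply hχ
  refine (Submodule.eq_bot_iff _).mpr fun f hf => sep χ f hf fun h => ?_
  exact hall χ _ (hT h χ f hf)

end Abstract

/-! ### The function model of PerL §3.1 / Prop 4.3: `τ`-valued functions on `G_U(𝔸) = G_{∞,ι₁} × G_c × G_f` -/

section FunctionModel

variable {Ginf Gc Gf V : Type*} [Group Ginf] [Group Gc] [Group Gf] [AddCommGroup V] [Module ℂ V]

/-- `u_f(g_{ι₁}) := F_f(g_{ι₁}, 1, …, 1; 1_f)` (PerL ll. 653–655), `F_f = (f¹,f²)` the `τ`-valued function of `f`. -/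
def uEval : (Ginf × Gc × Gf → V) →ₗ[ℂ] (Ginf → V) where
  toFun F g := F (g, 1, 1)
  map_add' _ _ := rfl
  map_smul' _ _ := rfl

/-- right translation `R(h_f)` by a finite-adelic element (PerL l. 656, l. 660) -/
def rTransl (h : Gf) : (Ginf × Gc × Gf → V) →ₗ[ℂ] (Ginf × Gc × Gf → V) where
  toFun F x := F (x.1, x.2.1, x.2.2 * h)
  map_add' _ _ := rfl
  map_smul' _ _ := rfl

/-- pull-back `γ^*` of `τ`-valued functions on `G_{∞,ι₁} ≅ U(2,1)` (one-forms on `𝔹² = U(2,1)/K_{ι₁}`) along the left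
action of `γ_{ι₁}` on `𝔹²` (PerL l. 655: "acting on `𝔹²` through `γ_{ι₁}`") -/
def lTransl (g : Ginf) : (Ginf → V) →ₗ[ℂ] (Ginf → V) where
  toFun φ y := φ (g * y)
  map_add' _ _ := rfl
  map_smul' _ _ := rfl

omit [Group Ginf] in
/-- (Ported verbatim from the HodgeCMPerL package; no docstring in the source.) -/
@[simp] theorem uEval_apply (F : Ginf × Gc × Gf → V) (g : Ginf) : uEval F g = F (g, 1, 1) := rfl

omit [Group Ginf] [Group Gc] in
/-- (Ported verbatim from the HodgeCMPerL package; no docstring in the source.) -/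
@[simp] theorem rTransl_apply (h : Gf) (F : Ginf × Gc × Gf → V) (x : Ginf × Gc × Gf) :
    rTransl h F x = F (x.1, x.2.1, x.2.2 * h) := rfl

/-- (Ported verbatim from the HodgeCMPerL package; no docstring in the source.) -/
@[simp] theorem lTransl_apply (g : Ginf) (φ : Ginf → V) (y : Ginf) : lTransl g φ y = φ (g * y) := rfl

/-- (Ported verbatim from the HodgeCMPerL package; no docstring in the source.) -/
theorem lTransl_lTransl_inv (g : Ginf) (φ : Ginf → V) : lTransl g (lTransl g⁻¹ φ) = φ := by
  ext y; simp

/-- **N33b's equivariance, in the model** (PerL l. 655–656): for `F` left-invariant under `γ = (γ_{ι₁}, γ_c, γ_f)`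
and invariant under the compact factors, `γ^* u_F = u_{R(γ_f⁻¹) F}`. -/
theorem uEval_lTransl (F : Ginf × Gc × Gf → V) (γ : Ginf × Gc × Gf) (hγ : ∀ x, F (γ * x) = F x)
    (hc : ∀ (g : Ginf) (c : Gc) (k : Gf), F (g, c, k) = F (g, 1, k)) :
    lTransl γ.1 (uEval F) = uEval (rTransl γ.2.2⁻¹ F) := by
  ext y
  have h1 : (γ.1 * y, (1 : Gc), (1 : Gf)) = γ * (y, γ.2.1⁻¹, γ.2.2⁻¹) := by
    ext <;> simp
  simp only [lTransl_apply, uEval_apply, rTransl_apply, one_mul]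
  rw [h1, hγ, hc]

omit [Group Ginf] in
/-- **PerL l. 660, in the model**: a function invariant under the compact factors all of whose finite-adelic
translates have vanishing `u` is zero. -/
theorem eq_zero_of_uEval_rTransl (F : Ginf × Gc × Gf → V)
    (hc : ∀ (g : Ginf) (c : Gc) (k : Gf), F (g, c, k) = F (g, 1, k)) (h0 : ∀ h : Gf, uEval (rTransl h F) = 0) :
    F = 0 := by
  funext x
  obtain ⟨g, c, k⟩ := x
  have := congr_fun (h0 k) g
  simp only [uEval_apply, rTransl_apply, one_mul, Pi.zero_apply] at this
  rw [Pi.zero_apply, hc, this]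

end FunctionModel

/-! ### The node: data, inputs, statement, proof -/

/-- **Placeholder DATA for Prop 4.3's proof** (LEMMAS.md §3 defs-needed D2 "automorphic forms on `G_U` as
`K_∞`-equivariant functions" and D6 "holomorphic 1-forms on `𝔹²`"; to be replaced by / identified with the carver's
structure).  For ONE surface datum `(L, ι₁, (V₃,h))` and the FIXED lines `(W_i, μ_i)`, `i ∈ {1,2}`, of PerL §3.2:
* `Ginf = U(V_{3,ι₁}) ≅ U(2,1)`, `Gc = ∏_{b ≠ ι₁} U(V_{3,b})(ℝ) ≅ U(3)^{d-1}`, `Gf = G_U(𝔸_{L₀,f})`, so that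
  `G_U(𝔸_{L₀}) = Ginf × Gc × Gf` (PerL l. 239, l. 654);
* `Γ` = the image of `G_U(L₀)` under the diagonal embedding (l. 655);
* `V` = the fibre `τ = 𝔭₊^∨` with its weight basis (`≅ ℂ²`, l. 240, l. 245);
* `X i` = the automorphic characters `χ'_i` of `[U(W_i)]` of archimedean type `e(Ψ_i)` (l. 644–645, l. 658) — the
  repair of R1: NO other parameter (the line `W_i` and the splitting character `μ_i` are fixed);
* `ThetaP i χ` = `Θ_i(χ'_i)[𝔭₊]` (l. 645–646), transported along the injective map `f ↦ F_f = (f¹, f²)` (components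
  along the weight basis, l. 651) into `τ`-valued functions on `G_U(𝔸)`;
* `Hol` = the holomorphic one-forms on `𝔹²`, as `τ`-valued functions on `U(2,1)` (l. 241–243, l. 653–655). -/
structure LineSpanData where
  /-- `U(V_{3,ι₁}) ≅ U(2,1)` -/
  Ginf : Type
  /-- the compact factors `∏_{b ≠ ι₁} U(3)` -/
  Gc : Type
  /-- `G_U(𝔸_f)` -/
  Gf : Type
  [iGinf : Group Ginf]
  [iGc : Group Gc]
  [iGf : Group Gf]
  /-- the fibre `τ = 𝔭₊^∨ ≅ ℂ²` -/
  V : Type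
  [iV₁ : AddCommGroup V]
  [iV₂ : Module ℂ V]
  /-- the image of `G_U(L₀)` in `G_U(𝔸) = Ginf × Gc × Gf` -/
  Γ : Subgroup (Ginf × Gc × Gf)
  /-- index `i ↦` the automorphic characters `χ'_i` of `[U(W_i)]` of archimedean type `e(Ψ_i)` (FIXED `W_i, μ_i`) -/
  X : Fin 2 → Type
  /-- `Θ_i(χ'_i)[𝔭₊]` as `τ`-valued functions on `G_U(𝔸)` -/
  ThetaP : (i : Fin 2) → X i → Submodule ℂ (Ginf × Gc × Gf → V)
  /-- holomorphic one-forms on `𝔹²` as `τ`-valued functions on `U(2,1)` -/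
  Hol : Submodule ℂ (Ginf → V)

attribute [instance] LineSpanData.iGinf LineSpanData.iGc LineSpanData.iGf LineSpanData.iV₁ LineSpanData.iV₂

namespace LineSpanData

variable (D : LineSpanData)

/-- **`𝒰_i`** (PerL l. 658): the span of the `u_f`, `f ∈ Θ_i(χ'_i)[𝔭₊]`, `χ'_i` automorphic of type `e(Ψ_i)`. -/
def U (i : Fin 2) : Submodule ℂ (D.Ginf → D.V) := USpan uEval (D.ThetaP i)

/-- INPUT (N09/N10, tex ll. 241, 264–268): theta functions are functions on `G_U(L₀)\G_U(𝔸)`. -/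
def LeftInvariant : Prop :=
  ∀ (i : Fin 2) (χ : D.X i), ∀ F ∈ D.ThetaP i χ, ∀ γ ∈ D.Γ, ∀ x, F (γ * x) = F x

/-- INPUT (N09, tex ll. 239–240, 246, 654): `K_∞`-type `𝔭₊ ⊠ 𝟏` ⇒ invariant under the compact factors
`U(V_{3,b})(ℝ) = U(3)`, `b ≠ ι₁` (the whole local group at `b`). -/
def CompactInvariant : Prop :=
  ∀ (i : Fin 2) (χ : D.X i), ∀ F ∈ D.ThetaP i χ, ∀ (g : D.Ginf) (c : D.Gc) (k : D.Gf), F (g, c, k) = F (g, 1, k)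

/-- INPUT (N10, tex ll. 264–268; used at l. 656 and l. 660): `Θ_i(χ'_i)[𝔭₊]` is stable under `R(h_f)`,
`h_f ∈ G_U(𝔸_f)` (`Θ^W_μ(χ')` is a `G_U(𝔸_f)`-module and `R(h_f)` commutes with `K_∞`). -/
def FiniteStable : Prop :=
  ∀ (i : Fin 2) (χ : D.X i) (h : D.Gf), ∀ F ∈ D.ThetaP i χ, rTransl h F ∈ D.ThetaP i χ

/-- INPUT (N33b, tex ll. 650–655): `u_f` is a holomorphic one-form on `𝔹²`. -/
def UHolomorphic : Prop :=
  ∀ (i : Fin 2) (χ : D.X i), ∀ F ∈ D.ThetaP i χ, uEval F ∈ D.Hol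

/-- INPUT (N30 = Lemma 4.2(a), tex ll. 527–529, with N33a, tex ll. 644–650): for each `i` there is an automorphic
character `χ'_i` of type `e(Ψ_i)`, and `Θ_i(χ'_i)[𝔭₊] ≠ 0`. -/
def SomeNonzero : Prop :=
  ∀ i : Fin 2, ∃ χ : D.X i, D.ThetaP i χ ≠ ⊥

/-- **N33c** (PerL v5 tex ll. 658–660), typed verbatim over the placeholder data: for `i ∈ {1,2}`, `𝒰_i` is a complex
vector space of holomorphic one-forms on `𝔹²` (a `ℂ`-subspace of `Hol`), stable under `γ^*` for `γ ∈ G_U(L₀)` (indeed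
`γ^* 𝒰_i = 𝒰_i`), and non-zero. -/
def N33c_statement : Prop :=
  ∀ i : Fin 2,
    D.U i ≤ D.Hol ∧ (∀ γ ∈ D.Γ, (D.U i).map (lTransl γ.1) = D.U i) ∧ D.U i ≠ ⊥

/-- (Ported verbatim from the HodgeCMPerL package; no docstring in the source.) -/
theorem U_def (i : Fin 2) : D.U i = USpan uEval (D.ThetaP i) := rfl

/-- (Ported verbatim from the HodgeCMPerL package; no docstring in the source.) -/
theorem U_map_lTransl_le (h1 : D.LeftInvariant) (h2 : D.CompactInvariant) (h3 : D.FiniteStable) (i : Fin 2)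
    (γ : D.Ginf × D.Gc × D.Gf) (hγ : γ ∈ D.Γ) : (D.U i).map (lTransl γ.1) ≤ D.U i := by
  rw [U_def]
  refine USpan_map_le uEval (D.ThetaP i) (lTransl γ.1) (rTransl γ.2.2⁻¹) ?_ ?_
  · intro χ F hF
    exact h3 i χ γ.2.2⁻¹ F hF
  · intro χ F hF
    exact uEval_lTransl F γ (h1 i χ F hF γ hγ) (h2 i χ F hF)

/-- **Proof of N33c** from the listed inputs (all of them outputs of other DAG nodes; nothing cited). -/
theorem N33c_of (h1 : D.LeftInvariant) (h2 : D.CompactInvariant) (h3 : D.FiniteStable) (h4 : D.UHolomorphic)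
    (h5 : D.SomeNonzero) : D.N33c_statement := by
  intro i
  refine ⟨?_, fun γ hγ => ?_, ?_⟩
  · rw [U_def]
    exact USpan_le uEval (D.ThetaP i) (h4 i)
  · have hle := D.U_map_lTransl_le h1 h2 h3 i γ hγ
    have hle' := D.U_map_lTransl_le h1 h2 h3 i γ⁻¹ (D.Γ.inv_mem hγ)
    rw [Prod.fst_inv] at hle'
    rw [U_def] at hle hle' ⊢
    exact USpan_map_eq uEval (D.ThetaP i) (lTransl γ.1) (lTransl γ.1⁻¹) (lTransl_lTransl_inv γ.1) hle hle'
  · rw [U_def]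
    refine USpan_ne_bot uEval (D.ThetaP i) (fun h : D.Gf => rTransl h) ?_ ?_ (h5 i)
    · intro h χ F hF
      exact h3 i χ h F hF
    · intro χ F hF h0
      exact eq_zero_of_uEval_rTransl F (h2 i χ F hF) h0

/-- The membership form of (2) used downstream (N33e, l. 672: "`γ^* 𝒰₂ = 𝒰₂` gives `γΩ = Ω`"). -/
theorem lTransl_mem_U (h1 : D.LeftInvariant) (h2 : D.CompactInvariant) (h3 : D.FiniteStable) (i : Fin 2)
    {γ : D.Ginf × D.Gc × D.Gf} (hγ : γ ∈ D.Γ) {φ : D.Ginf → D.V} (hφ : φ ∈ D.U i) : lTransl γ.1 φ ∈ D.U i :=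
  D.U_map_lTransl_le h1 h2 h3 i γ hγ (Submodule.mem_map_of_mem hφ)

end LineSpanData

end HodgeCM.PerL34.P43
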